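import Literature.AlgebraicGeometry.RelativeSpec.GeometricQuotientRecognition
import Literature.AlgebraicGeometry.Motives.MumfordTateInvariantsScalarExtension
import Mathlib.AlgebraicGeometry.Morphisms.Flat
import Mathlib.Algebra.Category.Ring.Constructions
import Mathlib.RingTheory.Flat.Basic
import HarnessLib

/-!
# Geometric quotients by finite groups commute with extension of the base field
# (SGA 1, Exp. V, Prop. 1.9; Mumford, *Abelian Varieties*, §7, Theorem p. 66)

SGA 1, Exp. V, Prop. 1.9: "la formation du quotient `X/G` commute au changement de base plat". This
file proves the case of a change of base FIELD `Spec K → Spec k` (any field extension, automatically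
flat): if a finite group `G` acts on `X` over `Spec k` and `p : X → Q` is an affine geometric quotient
over `k` (Mumford's conditions (1), (2): `ActionOver.IsGeometricQuotient`, e.g. the tree's `X → X/G`),
then the base change `p_K : X_K → Q_K` is a geometric quotient of `X_K = X ×_k Spec K` by the base-changed
action (`ActionOver.isGeometricQuotient_baseChange`); in particular `p_K` is again a categorical quotient
for separated targets (`IsGeometricQuotient.existsUnique_desc`).

Proof (Mumford's (2) on an affine cover, then `ActionOver.isGeometricQuotient_of_range_app`): for an
affine open `V ⊆ Q`, the sections of `Q_K` over `V_K` and of `X_K` over `(p⁻¹V)_K` are the base changes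
`K ⊗_k Γ(Q, V)`, `K ⊗_k Γ(X, p⁻¹V)` (`isPushout_sections_baseChange`, Mathlib
`isIso_pushoutSection_of_isAffineOpen`); `p♯` stays injective after `K ⊗_k –` (`K` is flat over the field
`k`) and the `G`-invariants of `K ⊗_k Γ(X, p⁻¹V)` are `K ⊗_k Γ(X, p⁻¹V)^G = K ⊗_k Γ(Q, V)` ("invariants
commute with extension of scalars", the tree's `Motives.setOf_forall_eq_span_image_of_isBaseChange`).

* `injective_of_isBaseChange` (and the private `range_eq_span_of_isBaseChange`) — linear algebra of base
  change along a field extension;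
* `isPushout_sections_baseChange` — `Γ(X_K, (pr₁)⁻¹U) = K ⊗_k Γ(X, U)` for `U ⊆ X` affine open;
* `ActionOver.isGeometricQuotient_baseChange` — the theorem.

Everything is proved; no named facts and no definitions.

Mathlib searched (pin): `isIso_pushoutSection_of_isAffineOpen`, `isIso_pushoutSection_iff`,
`CommRingCat.isPushout_iff_isPushout`, `Algebra.IsPushout.out`, `IsBaseChange.equiv`,
`IsBaseChange.inductionOn`, `Module.Flat.lTensor_preserves_injective_linearMap`, `IsPullback.of_bot`,
`MorphismProperty.IsStableUnderBaseChange.of_isPullback` (all used); Mathlib has fpqc descent of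
morphisms but no quotients of schemes by finite groups.

## References

* A. Grothendieck, *SGA 1*, Exp. V, §1, Prop. 1.9 (quotients commute with flat base change). [SGA1]
* D. Mumford, *Abelian Varieties* (1970), §7, Theorem p. 66 and its proof. [MumfordAV1970]
-/

noncomputable section

universe u

open CategoryTheory Limits AlgebraicGeometry Opposite TensorProduct

namespace Literature.AlgebraicGeometry.RelativeSpec

/-! ### Linear algebra of base change along a field extension -/

section Algebra

variable {k K : Type*} [Field k] [CommRing K] [Algebra k K]
  {M N M₂ N₂ : Type*} [AddCommGroup M] [Module k M] [AddCommGroup N] [Module k N] [Module K N]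
  [IsScalarTower k K N] [AddCommGroup M₂] [Module k M₂] [AddCommGroup N₂] [Module k N₂] [Module K N₂]
  [IsScalarTower k K N₂] {j₁ : M →ₗ[k] N} {j₂ : M₂ →ₗ[k] N₂}

/-- A `K`-linear map extending a `k`-linear map along base changes is the base change: on
`K ⊗_k M` it is `1 ⊗ φ` transported along the identifications. [folklore] -/
private theorem apply_equiv_eq_of_isBaseChange (h₁ : IsBaseChange K j₁) (h₂ : IsBaseChange K j₂)
    (φ : M →ₗ[k] M₂) (φ' : N →ₗ[K] N₂) (hc : ∀ x, φ' (j₁ x) = j₂ (φ x)) (z : K ⊗[k] M) :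
    φ' (h₁.equiv z) = h₂.equiv (φ.baseChange K z) := by
  induction z using TensorProduct.induction_on with
  | zero => simp
  | tmul c m => rw [LinearMap.baseChange_tmul, h₁.equiv_tmul, h₂.equiv_tmul, map_smul, hc]
  | add x y hx hy => rw [map_add, map_add, hx, hy, map_add, map_add]

/-- **Injectivity survives base change along a field extension**: if `φ' : N → N₂` is `K`-linear and
extends the injective `k`-linear `φ : M → M₂` along base changes `j₁ : M → N`, `j₂ : M₂ → N₂` to the
FLAT `k`-algebra `K` (e.g. a field extension), then `φ'` is injective (`φ' ≅ 1_K ⊗ φ`).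
[cite: SGA1, Exp. V Prop. 1.9 (proof)] -/
theorem injective_of_isBaseChange [Module.Flat k K] (h₁ : IsBaseChange K j₁) (h₂ : IsBaseChange K j₂)
    (φ : M →ₗ[k] M₂) (φ' : N →ₗ[K] N₂) (hc : ∀ x, φ' (j₁ x) = j₂ (φ x))
    (hφ : Function.Injective φ) : Function.Injective φ' := by
  intro x y hxy
  obtain ⟨z, rfl⟩ := h₁.equiv.surjective x
  obtain ⟨w, rfl⟩ := h₁.equiv.surjective y
  rw [apply_equiv_eq_of_isBaseChange h₁ h₂ φ φ' hc, apply_equiv_eq_of_isBaseChange h₁ h₂ φ φ' hc] at hxy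
  have h := h₂.equiv.injective hxy
  rw [LinearMap.baseChange_eq_ltensor] at h
  rw [Module.Flat.lTensor_preserves_injective_linearMap φ hφ h]

omit [IsScalarTower k K N₂] in
/-- **The image of a base-changed map is spanned by the image**: with `φ'` extending `φ` along base
changes as above, `range φ' = K · j₂(range φ)`. [folklore] -/
private theorem range_eq_span_of_isBaseChange (h₁ : IsBaseChange K j₁) (φ : M →ₗ[k] M₂) (φ' : N →ₗ[K] N₂)
    (hc : ∀ x, φ' (j₁ x) = j₂ (φ x)) :
    (LinearMap.range φ' : Set N₂) = Submodule.span K (j₂ '' Set.range φ) := by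
  apply le_antisymm
  · rintro _ ⟨x, rfl⟩
    refine h₁.inductionOn x (fun x => φ' x ∈ Submodule.span K (j₂ '' Set.range φ)) ?_ ?_ ?_ ?_
    · rw [map_zero]; exact Submodule.zero_mem _
    · intro m
      rw [hc]
      exact Submodule.subset_span ⟨φ m, ⟨m, rfl⟩, rfl⟩
    · intro c n hn
      rw [map_smul]
      exact Submodule.smul_mem _ c hn
    · intro n₁ n₂ h₁' h₂'
      rw [map_add]
      exact Submodule.add_mem _ h₁' h₂'
  · refine SetLike.coe_subset_coe.mpr (Submodule.span_le.mpr ?_)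
    rintro _ ⟨_, ⟨m, rfl⟩, rfl⟩
    exact ⟨j₁ m, hc m⟩

end Algebra

/-! ### Sections along commutative triangles; sections of a base change over an affine open -/

section Sections

/-- `g♯` followed by `f♯` on compatible opens is `h♯` when `f ≫ g = h`. [folklore] -/
private theorem appLE_comp_appLE_of_comp_eq {X Y Z : Scheme.{u}} {f : X ⟶ Y} {g : Y ⟶ Z} {h : X ⟶ Z}
    (e : f ≫ g = h) (U : Z.Opens) (V : Y.Opens) (W : X.Opens) (hV : V ≤ g ⁻¹ᵁ U) (hW : W ≤ f ⁻¹ᵁ V)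
    (hW' : W ≤ h ⁻¹ᵁ U) : g.appLE U V hV ≫ f.appLE V W hW = h.appLE U W hW' := by
  subst e
  exact Scheme.Hom.appLE_comp_appLE _ _ _ _ _ _ _

/-- Pointwise form of `appLE_comp_appLE_of_comp_eq`. [folklore] -/
private theorem appLE_appLE_apply_of_comp_eq {X Y Z : Scheme.{u}} {f : X ⟶ Y} {g : Y ⟶ Z} {h : X ⟶ Z}
    (e : f ≫ g = h) (U : Z.Opens) (V : Y.Opens) (W : X.Opens) (hV : V ≤ g ⁻¹ᵁ U) (hW : W ≤ f ⁻¹ᵁ V)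
    (hW' : W ≤ h ⁻¹ᵁ U) (s : Γ(Z, U)) :
    f.appLE V W hW (g.appLE U V hV s) = h.appLE U W hW' s := by
  rw [← CommRingCat.comp_apply, appLE_comp_appLE_of_comp_eq e]

/-- `f♯` on `⊤ ≤ f⁻¹⊤` is `f.appTop`. [folklore] -/
private theorem appLE_top_top {X Y : Scheme.{u}} (f : X ⟶ Y) (e : (⊤ : X.Opens) ≤ f ⁻¹ᵁ ⊤) :
    f.appLE ⊤ ⊤ e = f.appTop := by
  rw [Scheme.Hom.appTop, Scheme.Hom.app_eq_appLE]
  rfl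

variable {k K : Type u} [Field k] [Field K] (φ : k →+* K) {X : Scheme.{u}} (iX : X ⟶ Spec (.of k))

/-- **Sections of a base change over an affine open** (the affine case of "cohomology and flat base
change"; Mathlib `isIso_pushoutSection_of_isAffineOpen`): for `X → Spec k`, a field extension
`φ : k → K` and an affine open `U ⊆ X`, the square of rings
`k → Γ(X, U)`, `k → K`, `Γ(X, U) → Γ(X_K, pr₁⁻¹U)`, `K → Γ(X_K, pr₁⁻¹U)` is cocartesian:
`Γ(X_K, pr₁⁻¹U) = K ⊗_k Γ(X, U)`. [cite: SGA1, Exp. V Prop. 1.9 (proof)] -/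
theorem isPushout_sections_baseChange {U : X.Opens} (hU : IsAffineOpen U)
    (U' : (pullback iX (Spec.map (CommRingCat.ofHom φ))).Opens)
    (hU' : U' = pullback.fst iX (Spec.map (CommRingCat.ofHom φ)) ⁻¹ᵁ U) :
    IsPushout ((Scheme.ΓSpecIso (.of k)).inv ≫ iX.appLE ⊤ U le_top) (CommRingCat.ofHom φ)
      ((pullback.fst iX (Spec.map (CommRingCat.ofHom φ))).appLE U U' hU'.le)
      ((Scheme.ΓSpecIso (.of K)).inv ≫
        (pullback.snd iX (Spec.map (CommRingCat.ofHom φ))).appLE ⊤ U' le_top) := by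
  have H := IsPullback.of_hasPullback iX (Spec.map (CommRingCat.ofHom φ))
  have hUY : U' = pullback.fst iX (Spec.map (CommRingCat.ofHom φ)) ⁻¹ᵁ U ⊓
      pullback.snd iX (Spec.map (CommRingCat.ofHom φ)) ⁻¹ᵁ ⊤ := by
    rw [hU', Scheme.Hom.preimage_top, inf_top_eq]
  have hiso := isIso_pushoutSection_of_isAffineOpen H (US := ⊤) (UT := ⊤) (UX := U) (UY := U')
    le_top le_top hUY (isAffineOpen_top _) (isAffineOpen_top _) hU
  have hpo := (isIso_pushoutSection_iff H (US := ⊤) (UT := ⊤) (UX := U) (UY := U') le_top le_top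
    hUY).mp hiso
  refine hpo.of_iso (Scheme.ΓSpecIso _) (Iso.refl _) (Scheme.ΓSpecIso _) (Iso.refl _) ?_ ?_ ?_ ?_
  · rw [Iso.refl_hom, Category.comp_id, Iso.hom_inv_id_assoc]
  · rw [appLE_top_top]
    exact Scheme.ΓSpecIso_naturality (CommRingCat.ofHom φ)
  · rw [Iso.refl_hom, Iso.refl_hom, Category.comp_id, Category.id_comp]
  · rw [Iso.refl_hom, Category.comp_id, Iso.hom_inv_id_assoc]

end Sections

/-! ### The theorem -/

namespace ActionOver

variable {k K : Type u} [Field k] [Field K] (φ : k →+* K)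
  {X Q : Scheme.{u}} {iX : X ⟶ Spec (.of k)} {iQ : Q ⟶ Spec (.of k)} {p : X ⟶ Q}
  {G : Type*} [Group G] [Finite G] (ρ : ActionOver iX G)

set_option backward.isDefEq.respectTransparency false

omit [Finite G] in
/-- **Mumford's condition (2) after extension of the base field, on the affine cover `{V_K}`.** For a
geometric quotient `p : X → Q` over `k` (affine) and an affine open `V ⊆ Q`, the base change
`p_K♯ : Γ(Q_K, V_K) → Γ(X_K, p_K⁻¹V_K)` is injective with image the `G`-invariants: both rings are the
base changes `K ⊗_k Γ(Q, V)`, `K ⊗_k Γ(X, p⁻¹V)` (`isPushout_sections_baseChange`), `p♯` is injective with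
image `Γ(X, p⁻¹V)^G` (`IsGeometricQuotient.app_injective`, `range_app`), `K ⊗_k –` preserves injectivity
(`injective_of_isBaseChange`) and invariants (`Motives.setOf_forall_eq_span_image_of_isBaseChange`).
[cite: SGA1, Exp. V Prop. 1.9] [cite: MumfordAV1970, §7 Thm. p. 66 (2)] -/
theorem injective_app_and_range_app_baseChange (hp : p ≫ iQ = iX) (hq : ρ.IsGeometricQuotient p)
    [IsAffineHom p]
    (ρ' : ActionOver (pullback.snd iX (Spec.map (CommRingCat.ofHom φ))) G)
    (hρ' : ∀ g : G, (ρ'.aut g).hom ≫ pullback.fst iX (Spec.map (CommRingCat.ofHom φ)) =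
      pullback.fst iX (Spec.map (CommRingCat.ofHom φ)) ≫ (ρ.aut g).hom)
    (p' : pullback iX (Spec.map (CommRingCat.ofHom φ)) ⟶ pullback iQ (Spec.map (CommRingCat.ofHom φ)))
    (hp'₁ : p' ≫ pullback.fst iQ _ = pullback.fst iX _ ≫ p)
    (hp'₂ : p' ≫ pullback.snd iQ _ = pullback.snd iX _)
    (hinv' : ∀ g : G, (ρ'.aut g).hom ≫ p' = p') (V : Q.affineOpens) :
    Function.Injective (p'.app (pullback.fst iQ (Spec.map (CommRingCat.ofHom φ)) ⁻¹ᵁ V.1)) ∧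
      Set.range (p'.app (pullback.fst iQ (Spec.map (CommRingCat.ofHom φ)) ⁻¹ᵁ V.1)) =
        {s | ∀ g : G, (ρ'.aut g⁻¹).hom.appLE
          (p' ⁻¹ᵁ (pullback.fst iQ (Spec.map (CommRingCat.ofHom φ)) ⁻¹ᵁ V.1))
          (p' ⁻¹ᵁ (pullback.fst iQ (Spec.map (CommRingCat.ofHom φ)) ⁻¹ᵁ V.1))
          ((⟨ρ'.aut, hinv'⟩ : ActionOver p' G).preimage_preimage g⁻¹ _).ge s = s} := by
  -- notation
  let fX := pullback.fst iX (Spec.map (CommRingCat.ofHom φ))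
  let sX := pullback.snd iX (Spec.map (CommRingCat.ofHom φ))
  let fQ := pullback.fst iQ (Spec.map (CommRingCat.ofHom φ))
  let sQ := pullback.snd iQ (Spec.map (CommRingCat.ofHom φ))
  let U : (pullback iQ (Spec.map (CommRingCat.ofHom φ))).Opens := fQ ⁻¹ᵁ V.1
  let B : X.Opens := p ⁻¹ᵁ V.1
  have hBaff : IsAffineOpen B := V.2.preimage p
  let B' : (pullback iX (Spec.map (CommRingCat.ofHom φ))).Opens := p' ⁻¹ᵁ U
  have hB' : B' = fX ⁻¹ᵁ B := by
    change p' ⁻¹ᵁ (fQ ⁻¹ᵁ V.1) = fX ⁻¹ᵁ (p ⁻¹ᵁ V.1)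
    rw [← Scheme.Hom.comp_preimage, hp'₁, Scheme.Hom.comp_preimage]
  have eB : ∀ g : G, B ≤ (ρ.aut g).hom ⁻¹ᵁ B := fun g =>
    ((⟨ρ.aut, hq.comp_eq⟩ : ActionOver p G).preimage_preimage g V.1).ge
  have eB' : ∀ g : G, B' ≤ (ρ'.aut g).hom ⁻¹ᵁ B' := fun g =>
    ((⟨ρ'.aut, hinv'⟩ : ActionOver p' G).preimage_preimage g U).ge
  -- the two cocartesian squares of sections
  have PA := isPushout_sections_baseChange φ iQ V.2 U rfl
  have PB := isPushout_sections_baseChange φ iX hBaff B' hB'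
  -- algebra structures
  letI : Algebra k K := φ.toAlgebra
  letI algA : Algebra k Γ(Q, V.1) :=
    ((Scheme.ΓSpecIso (.of k)).inv ≫ iQ.appLE ⊤ V.1 le_top).hom.toAlgebra
  letI algB : Algebra k Γ(X, B) := ((Scheme.ΓSpecIso (.of k)).inv ≫ iX.appLE ⊤ B le_top).hom.toAlgebra
  letI algA' : Algebra K Γ(pullback iQ (Spec.map (CommRingCat.ofHom φ)), U) :=
    ((Scheme.ΓSpecIso (.of K)).inv ≫ sQ.appLE ⊤ U le_top).hom.toAlgebra
  letI algB' : Algebra K Γ(pullback iX (Spec.map (CommRingCat.ofHom φ)), B') :=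
    ((Scheme.ΓSpecIso (.of K)).inv ≫ sX.appLE ⊤ B' le_top).hom.toAlgebra
  letI algAA' : Algebra Γ(Q, V.1) Γ(pullback iQ (Spec.map (CommRingCat.ofHom φ)), U) :=
    (fQ.appLE V.1 U le_rfl).hom.toAlgebra
  letI algBB' : Algebra Γ(X, B) Γ(pullback iX (Spec.map (CommRingCat.ofHom φ)), B') :=
    (fX.appLE B B' hB'.le).hom.toAlgebra
  letI algkA' : Algebra k Γ(pullback iQ (Spec.map (CommRingCat.ofHom φ)), U) :=
    ((algebraMap K Γ(pullback iQ (Spec.map (CommRingCat.ofHom φ)), U)).comp φ).toAlgebra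
  letI algkB' : Algebra k Γ(pullback iX (Spec.map (CommRingCat.ofHom φ)), B') :=
    ((algebraMap K Γ(pullback iX (Spec.map (CommRingCat.ofHom φ)), B')).comp φ).toAlgebra
  haveI : IsScalarTower k K Γ(pullback iQ (Spec.map (CommRingCat.ofHom φ)), U) :=
    IsScalarTower.of_algebraMap_eq' rfl
  haveI : IsScalarTower k K Γ(pullback iX (Spec.map (CommRingCat.ofHom φ)), B') :=
    IsScalarTower.of_algebraMap_eq' rfl
  haveI : IsScalarTower k Γ(Q, V.1) Γ(pullback iQ (Spec.map (CommRingCat.ofHom φ)), U) :=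
    IsScalarTower.of_algebraMap_eq' (RingHom.ext fun c => by
      have h := ConcreteCategory.congr_hom PA.w c
      exact h.symm)
  haveI : IsScalarTower k Γ(X, B) Γ(pullback iX (Spec.map (CommRingCat.ofHom φ)), B') :=
    IsScalarTower.of_algebraMap_eq' (RingHom.ext fun c => by
      have h := ConcreteCategory.congr_hom PB.w c
      exact h.symm)
  have hA : Algebra.IsPushout k K Γ(Q, V.1) Γ(pullback iQ (Spec.map (CommRingCat.ofHom φ)), U) :=
    CommRingCat.isPushout_iff_isPushout.mp PA.flip
  have hB : Algebra.IsPushout k K Γ(X, B) Γ(pullback iX (Spec.map (CommRingCat.ofHom φ)), B') :=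
    CommRingCat.isPushout_iff_isPushout.mp PB.flip
  have hjA := hA.out
  have hjB := hB.out
  -- `p♯` and `p_K♯` as algebra maps
  have hψk : ∀ c : k, p.app V.1 (algebraMap k Γ(Q, V.1) c) = algebraMap k Γ(X, B) c := fun c => by
    change p.app V.1 (iQ.appLE ⊤ V.1 le_top ((Scheme.ΓSpecIso (.of k)).inv c)) =
      iX.appLE ⊤ B le_top ((Scheme.ΓSpecIso (.of k)).inv c)
    rw [Scheme.Hom.app_eq_appLE]
    exact appLE_appLE_apply_of_comp_eq hp ⊤ V.1 B le_top le_rfl le_top _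
  let ψ : Γ(Q, V.1) →ₐ[k] Γ(X, B) := { toRingHom := (p.app V.1).hom, commutes' := hψk }
  have hψ'K : ∀ c : K, p'.app U (algebraMap K _ c) =
      algebraMap K Γ(pullback iX (Spec.map (CommRingCat.ofHom φ)), B') c := fun c => by
    change p'.app U (sQ.appLE ⊤ U le_top ((Scheme.ΓSpecIso (.of K)).inv c)) =
      sX.appLE ⊤ B' le_top ((Scheme.ΓSpecIso (.of K)).inv c)
    rw [Scheme.Hom.app_eq_appLE]
    exact appLE_appLE_apply_of_comp_eq hp'₂ ⊤ U B' le_top le_rfl le_top _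
  let ψ' : Γ(pullback iQ (Spec.map (CommRingCat.ofHom φ)), U) →ₐ[K]
      Γ(pullback iX (Spec.map (CommRingCat.ofHom φ)), B') :=
    { toRingHom := (p'.app U).hom, commutes' := hψ'K }
  have hcomm : ∀ a, ψ'.toLinearMap
      ((IsScalarTower.toAlgHom k Γ(Q, V.1) Γ(pullback iQ (Spec.map (CommRingCat.ofHom φ)), U)).toLinearMap a) =
      (IsScalarTower.toAlgHom k Γ(X, B) Γ(pullback iX (Spec.map (CommRingCat.ofHom φ)), B')).toLinearMap
        (ψ.toLinearMap a) := fun a => by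
    change p'.app U (fQ.appLE V.1 U le_rfl a) = fX.appLE B B' hB'.le (p.app V.1 a)
    rw [Scheme.Hom.app_eq_appLE, Scheme.Hom.app_eq_appLE,
      appLE_appLE_apply_of_comp_eq rfl V.1 U B' le_rfl le_rfl le_rfl,
      appLE_appLE_apply_of_comp_eq hp'₁.symm V.1 B B' le_rfl hB'.le le_rfl]
  -- the actions as algebra maps
  have hLk : ∀ (g : G) (c : k), (ρ.aut g⁻¹).hom.appLE B B (eB g⁻¹) (algebraMap k Γ(X, B) c) =
      algebraMap k Γ(X, B) c := fun g c => by
    change (ρ.aut g⁻¹).hom.appLE B B (eB g⁻¹) (iX.appLE ⊤ B le_top ((Scheme.ΓSpecIso (.of k)).inv c)) =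
      iX.appLE ⊤ B le_top ((Scheme.ΓSpecIso (.of k)).inv c)
    exact appLE_appLE_apply_of_comp_eq (ρ.aut_comp g⁻¹) ⊤ B B le_top (eB g⁻¹) le_top _
  let L : G → (Γ(X, B) →ₐ[k] Γ(X, B)) := fun g =>
    { toRingHom := ((ρ.aut g⁻¹).hom.appLE B B (eB g⁻¹)).hom, commutes' := hLk g }
  have hL'K : ∀ (g : G) (c : K), (ρ'.aut g⁻¹).hom.appLE B' B' (eB' g⁻¹)
      (algebraMap K Γ(pullback iX (Spec.map (CommRingCat.ofHom φ)), B') c) =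
      algebraMap K Γ(pullback iX (Spec.map (CommRingCat.ofHom φ)), B') c := fun g c => by
    change (ρ'.aut g⁻¹).hom.appLE B' B' (eB' g⁻¹) (sX.appLE ⊤ B' le_top ((Scheme.ΓSpecIso (.of K)).inv c)) =
      sX.appLE ⊤ B' le_top ((Scheme.ΓSpecIso (.of K)).inv c)
    exact appLE_appLE_apply_of_comp_eq (ρ'.aut_comp g⁻¹) ⊤ B' B' le_top (eB' g⁻¹) le_top _
  let L' : G → (Γ(pullback iX (Spec.map (CommRingCat.ofHom φ)), B') →ₐ[K]
      Γ(pullback iX (Spec.map (CommRingCat.ofHom φ)), B')) := fun g =>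
    { toRingHom := ((ρ'.aut g⁻¹).hom.appLE B' B' (eB' g⁻¹)).hom, commutes' := hL'K g }
  have hB'le : ∀ g : G, B' ≤ ((ρ'.aut g⁻¹).hom ≫ fX) ⁻¹ᵁ B := fun g => by
    rw [Scheme.Hom.comp_preimage, ← hB']
    exact eB' g⁻¹
  have hLL' : ∀ (g : G) (b : Γ(X, B)), (L' g).toLinearMap
      ((IsScalarTower.toAlgHom k Γ(X, B) Γ(pullback iX (Spec.map (CommRingCat.ofHom φ)), B')).toLinearMap b) =
      (IsScalarTower.toAlgHom k Γ(X, B) Γ(pullback iX (Spec.map (CommRingCat.ofHom φ)), B')).toLinearMap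
        ((L g).toLinearMap b) := fun g b => by
    change (ρ'.aut g⁻¹).hom.appLE B' B' (eB' g⁻¹) (fX.appLE B B' hB'.le b) =
      fX.appLE B B' hB'.le ((ρ.aut g⁻¹).hom.appLE B B (eB g⁻¹) b)
    rw [appLE_appLE_apply_of_comp_eq rfl B B' B' hB'.le (eB' g⁻¹) (hB'le g),
      appLE_appLE_apply_of_comp_eq (hρ' g⁻¹).symm B B B' (eB g⁻¹) hB'.le (hB'le g)]
  -- invariants commute with extension of scalars
  have key := Literature.AlgebraicGeometry.Motives.setOf_forall_eq_span_image_of_isBaseChange hjB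
    (fun g => (L g).toLinearMap) (fun _ => (LinearMap.id : Γ(X, B) →ₗ[k] Γ(X, B)))
    (fun g => (L' g).toLinearMap)
    (fun _ => (LinearMap.id : Γ(pullback iX (Spec.map (CommRingCat.ofHom φ)), B') →ₗ[K]
      Γ(pullback iX (Spec.map (CommRingCat.ofHom φ)), B'))) hLL' (fun _ _ => rfl)
  -- Mumford's (2) for `p`
  have hrangeB : Set.range (p.app V.1) =
      {x | ∀ g : G, (L g).toLinearMap x = (LinearMap.id : Γ(X, B) →ₗ[k] Γ(X, B)) x} :=
    hq.range_app V.1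
  refine ⟨?_, ?_⟩
  · exact injective_of_isBaseChange hjA hjB ψ.toLinearMap ψ'.toLinearMap hcomm (hq.app_injective V.1)
  · have h1 : Set.range (p'.app U) = (LinearMap.range ψ'.toLinearMap : Set _) := by
      rw [LinearMap.coe_range]
      rfl
    have h2 : Set.range ψ.toLinearMap =
        {x | ∀ g : G, (L g).toLinearMap x = (LinearMap.id : Γ(X, B) →ₗ[k] Γ(X, B)) x} := hrangeB
    rw [h1, range_eq_span_of_isBaseChange hjA ψ.toLinearMap ψ'.toLinearMap hcomm, h2, ← key]
    rfl

/-- **Geometric quotients by finite groups commute with extension of the base field** (SGA 1, Exp. V,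
Prop. 1.9, for the flat base change `Spec K → Spec k` of fields). Let `G` (finite) act on `X` over
`Spec k`, let `p : X → Q` be an AFFINE geometric quotient over `k` (Mumford's (1), (2); e.g. the tree's
`X → X/G`, which is affine), and let `p_K : X_K → Q_K` be its base change along a field extension
`φ : k → K`, with the base-changed action of `G` on `X_K = X ×_k Spec K`. Then `p_K` is a geometric
quotient of `X_K` by `G`; in particular (`IsGeometricQuotient.existsUnique_desc`) every `G`-invariant
morphism from `X_K` to a separated scheme factors uniquely through `p_K`. The base change is presented
by its projections (`hρ'`, `hp'₁`, `hp'₂`), so that the statement applies verbatim to `Over.pullback`.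
[cite: SGA1, Exp. V Prop. 1.9] [cite: MumfordAV1970, §7 Thm. p. 66] -/
theorem isGeometricQuotient_baseChange (hp : p ≫ iQ = iX) (hq : ρ.IsGeometricQuotient p)
    [IsAffineHom p]
    (ρ' : ActionOver (pullback.snd iX (Spec.map (CommRingCat.ofHom φ))) G)
    (hρ' : ∀ g : G, (ρ'.aut g).hom ≫ pullback.fst iX (Spec.map (CommRingCat.ofHom φ)) =
      pullback.fst iX (Spec.map (CommRingCat.ofHom φ)) ≫ (ρ.aut g).hom)
    (p' : pullback iX (Spec.map (CommRingCat.ofHom φ)) ⟶ pullback iQ (Spec.map (CommRingCat.ofHom φ)))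
    (hp'₁ : p' ≫ pullback.fst iQ _ = pullback.fst iX _ ≫ p)
    (hp'₂ : p' ≫ pullback.snd iQ _ = pullback.snd iX _) :
    ρ'.IsGeometricQuotient p' := by
  -- `p_K` is a base change of `p`, hence affine
  have big : IsPullback (pullback.fst iX (Spec.map (CommRingCat.ofHom φ)))
      (p' ≫ pullback.snd iQ (Spec.map (CommRingCat.ofHom φ))) (p ≫ iQ) (Spec.map (CommRingCat.ofHom φ)) := by
    rw [hp'₂, hp]
    exact IsPullback.of_hasPullback _ _
  have H : IsPullback (pullback.fst iX (Spec.map (CommRingCat.ofHom φ))) p' p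
      (pullback.fst iQ (Spec.map (CommRingCat.ofHom φ))) :=
    IsPullback.of_bot big hp'₁.symm (IsPullback.of_hasPullback _ _)
  haveI : IsAffineHom p' := MorphismProperty.IsStableUnderBaseChange.of_isPullback H inferInstance
  -- `p_K` is `G`-invariant
  have hinv' : ∀ g : G, (ρ'.aut g).hom ≫ p' = p' := fun g => by
    apply pullback.hom_ext
    · rw [Category.assoc, hp'₁, ← Category.assoc, hρ', Category.assoc, hq.comp_eq]
    · rw [Category.assoc, hp'₂, ρ'.aut_comp]
  -- recognition on the affine cover `{V_K}`
  haveI : IsAffineHom (pullback.fst iQ (Spec.map (CommRingCat.ofHom φ))) :=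
    MorphismProperty.pullback_fst _ _ inferInstance
  rw [← ρ'.isGeometricQuotient_overMap_iff p' hinv']
  refine (⟨ρ'.aut, hinv'⟩ : ActionOver p' G).isGeometricQuotient_of_range_app
    (fun V : Q.affineOpens => ⟨pullback.fst iQ (Spec.map (CommRingCat.ofHom φ)) ⁻¹ᵁ V.1, V.2.preimage _⟩)
    ?_ (fun V => (ρ.injective_app_and_range_app_baseChange φ hp hq ρ' hρ' p' hp'₁ hp'₂ hinv' V).1)
    (fun V => (ρ.injective_app_and_range_app_baseChange φ hp hq ρ' hρ' p' hp'₁ hp'₂ hinv' V).2)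
  change ⨆ V : Q.affineOpens, pullback.fst iQ (Spec.map (CommRingCat.ofHom φ)) ⁻¹ᵁ V.1 = ⊤
  rw [← Scheme.Hom.preimage_iSup, iSup_affineOpens_eq_top, Scheme.Hom.preimage_top]

end ActionOver

end Literature.AlgebraicGeometry.RelativeSpec

end
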